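import Literature.Algebra.Polynomial.CasasAlvero.Degree9CharP
import HarnessLib

/-!
# Casas-Alvero degrees in characteristic 11: the complete classification

`CharEleven.lean` decided every base-11 digit except `9`; `Degree9CharP.lean` supplies an explicit `F_11`-rational
Casas-Alvero polynomial of degree `9` (exhaustive normal-form search of the seat-2 g4 packet), so `CA_9` fails in
characteristic `11` and the classification closes: over every field of characteristic `11`, a degree `d` is Casas-Alvero
iff `d ∈ {0} ∪ {11^k, 2·11^k, 3·11^k, 4·11^k}`.
-/

noncomputable section

open Polynomial

namespace Literature.Algebra.Polynomial.CasasAlvero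

variable (K : Type*) [Field K] [CharP K 11]

/-- `¬ CA_{9·11^k}` in characteristic `11`. [folklore] -/
theorem not_holdsInDegree_nine_mul_eleven_pow (k : ℕ) : ¬ HoldsInDegree K (9 * 11 ^ k) := by
  haveI : Fact (Nat.Prime 11) := ⟨by norm_num⟩
  exact not_holdsInDegree_mul_prime_pow 11 k (not_holdsInDegree_nine_of_char_11 K)

/-- **characteristic 11, complete**: `CA_d ⟺ d ∈ {0} ∪ {11^k, 2·11^k, 3·11^k, 4·11^k}`.
[cite: GrafVonBothmerEtAl2007, Props. 2, 6, 7] -/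
theorem classification_char_eleven_complete (d : ℕ) :
    HoldsInDegree K d ↔ d = 0 ∨ ∃ k, d = 11 ^ k ∨ d = 2 * 11 ^ k ∨ d = 3 * 11 ^ k ∨ d = 4 * 11 ^ k := by
  refine ⟨fun h => ?_, (classification_char_eleven K d).2⟩
  rcases (classification_char_eleven K d).1 h with h0 | ⟨k, hk⟩
  · exact Or.inl h0
  · rcases hk with hk | hk | hk | hk | hk
    · exact Or.inr ⟨k, Or.inl hk⟩
    · exact Or.inr ⟨k, Or.inr (Or.inl hk)⟩
    · exact Or.inr ⟨k, Or.inr (Or.inr (Or.inl hk))⟩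
    · exact Or.inr ⟨k, Or.inr (Or.inr (Or.inr hk))⟩
    · exact absurd (hk ▸ h) (not_holdsInDegree_nine_mul_eleven_pow K k)

end Literature.Algebra.Polynomial.CasasAlvero
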